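import Literature.Topology.FourManifolds.DependentTripleGenusThreeTrisectionsProofs
import Literature.Topology.FourManifolds.CircleSurgery
import Literature.Topology.FourManifolds.LargeKTrisectionClassification
import Summits.SmoothPoincare4.SmoothPoincare4.Theorems.WeakReductionDescentDependentTripleGenusThreeStandard

/-!
# Sketch — crux-ideate `stmt-SmoothPoincare4-18000` (`DependentTripleGenusThreeStandard`),
# ideator k = 1, round 1: FIRST LEMMAS of the idea cards `five-chain-hub` and
# `pants-sphere-partner` (signatures over existing declarations; `sorry` only in the first lemmas;
# the two compositions at the end are proved and show the signatures fit the crux BY NAME).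
# Not a skeleton.
-/

noncomputable section

open scoped Manifold ContDiff
open Set ContinuousMap Literature.Topology.FourManifolds

namespace Summit.SmoothPoincare4.SmoothPoincare4.Cruxes.DependentTripleGenusThreeStandard.IdeaSketch

local notation "𝔼 " n:arg => EuclideanSpace ℝ (Fin n)
local notation "𝕊 " n:arg => (Metric.sphere (0 : EuclideanSpace ℝ (Fin (n + 1))) 1)

universe u

section Vocabulary

variable {X : Type u} [TopologicalSpace X] [ChartedSpace (𝔼 4) X]

/-- **Dual pair** (geometric intersection number one): two curves of the central surface meeting
in exactly one point, transversally — rendered through smooth parametrisations: at the common point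
the two velocity lines meet only in `0` (both lines lie in the tangent plane of the central
surface, so "distinct lines" is transversality inside the surface). [AZ25 p. 18: `|γ₂ ∩ β₁| = 1`.] -/
def IsDualPair (S : Fin 3 → Set X) (c c' : Set X) : Prop :=
  Trisection.IsCurve S c ∧ Trisection.IsCurve S c' ∧ (c ∩ c').ncard = 1 ∧
    ∃ (γ γ' : 𝕊 1 → X) (s t : 𝕊 1),
      Manifold.IsSmoothEmbedding (𝓡 1) (𝓡 4) ∞ γ ∧ Manifold.IsSmoothEmbedding (𝓡 1) (𝓡 4) ∞ γ' ∧
      range γ = c ∧ range γ' = c' ∧ γ s = γ' t ∧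
      ∀ v w, (mfderiv (𝓡 1) (𝓡 4) γ s v : 𝔼 4) = (mfderiv (𝓡 1) (𝓡 4) γ' t w : 𝔼 4) →
        (mfderiv (𝓡 1) (𝓡 4) γ s v : 𝔼 4) = 0

/-- Model open pair of pants: the unit `2`-sphere of `ℝ³` minus its three coordinate points. -/
def openPantsModel : Set (𝔼 3) :=
  Metric.sphere (0 : 𝔼 3) 1 \
    {EuclideanSpace.single 0 1, EuclideanSpace.single 1 1, EuclideanSpace.single 2 1}

/-- `A ⊆ F` cuts off an (open) pair of pants: some connected component of `F ∖ A` is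
homeomorphic to the thrice-punctured sphere. -/
def HasPantsComponent (F A : Set X) : Prop :=
  ∃ P : Set X, P ⊆ F \ A ∧ P.Nonempty ∧ (∀ x ∈ P, connectedComponentIn (F \ A) x = P) ∧
    Nonempty (P ≃ₜ openPantsModel)

/-- **Contains a five-chain** (Aranda–Zupan 2025, p. 18, verbatim roles `{γ₂, β₁, α₁, γ₁, β₂}`):
a centre `a` compressing in `H 0`, `b₁, b₂` compressing in `H 1`, `c₁, c₂` compressing in `H 2`,
with `c₂ ⟂ b₁ ⟂ a ⟂ c₁ ⟂ b₂` dual pairs (one transverse point each),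
`a ∩ b₂ = a ∩ c₂ = b₂ ∩ c₂ = b₁ ∩ c₁ = ∅` (and the same-handlebody pairs disjoint), and one
component of `F ∖ (a ∪ b₂ ∪ c₂)` a pair of pants. -/
def ContainsFiveChain (S : Fin 3 → Set X) : Prop :=
  ∃ a b₁ b₂ c₁ c₂ : Set X,
    Trisection.BoundsDisc S (Trisection.spineHandlebody S 0) a ∧
    Trisection.BoundsDisc S (Trisection.spineHandlebody S 1) b₁ ∧
    Trisection.BoundsDisc S (Trisection.spineHandlebody S 1) b₂ ∧
    Trisection.BoundsDisc S (Trisection.spineHandlebody S 2) c₁ ∧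
    Trisection.BoundsDisc S (Trisection.spineHandlebody S 2) c₂ ∧
    IsDualPair S c₂ b₁ ∧ IsDualPair S b₁ a ∧ IsDualPair S a c₁ ∧ IsDualPair S c₁ b₂ ∧
    Disjoint a b₂ ∧ Disjoint a c₂ ∧ Disjoint b₂ c₂ ∧ Disjoint b₁ c₁ ∧
    Disjoint b₁ b₂ ∧ Disjoint c₁ c₂ ∧
    HasPantsComponent (Trisection.centralSurfaceSet S) (a ∪ b₂ ∪ c₂)

end Vocabulary

/-! ### Card `five-chain-hub` — first lemmas (the two halves of the interface) -/

/-- **3-D half (crux-specific; AZ25 §7 ¶2–5 on Lemmas 3.7/3.8, Fig. 18 trichotomy, Remark 2.1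
slides).** A balanced genus-`3` GK-trisection of a smooth 4-manifold that admits a dependent
triple and is NOT weakly reducible contains a five-chain, up to relabelling the sectors.
(No homotopy-sphere hypothesis: it is a statement about genus-`3` Heegaard splittings of
`S¹ × S²`.) -/
theorem containsFiveChain_of_hasDependentTriple_of_not_isWeaklyReducible
    (M : Type) [TopologicalSpace M] [T2Space M] [SecondCountableTopology M]
    [ChartedSpace (𝔼 4) M] [IsManifold (𝓡 4) ∞ M]
    (T : Fin 3 → Set M) (hT : IsGKTrisection M 3 (fun _ => 1) T)
    (hdt : Trisection.HasDependentTriple T) (hwr : ¬ Trisection.IsWeaklyReducible T) :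
    ∃ σ : Equiv.Perm (Fin 3), ContainsFiveChain (T ∘ σ) := by
  sorry

/-- **4-D half = the HUB shared with Thm 1.3 (`GenusThreeBase`).** A smooth homotopy 4-sphere
with a balanced genus-`3` GK-trisection containing a five-chain is diffeomorphic to `S⁴`
(AZ25 Lemma 5.4 + Prop. 5.5 + [MSZ16 in place of MZ17b] + `S_1 = S'_1 = S⁴`). -/
def FiveChainStandardHS : Prop :=
  ∀ (M : Type) [TopologicalSpace M] [T2Space M] [SecondCountableTopology M]
    [ChartedSpace (𝔼 4) M] [IsManifold (𝓡 4) ∞ M],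
    M ≃ₕ 𝕊 4 → ∀ T : Fin 3 → Set M, IsGKTrisection M 3 (fun _ => 1) T →
      ContainsFiveChain T → Nonempty (M ≃ₘ⟮𝓡 4, 𝓡 4⟯ 𝕊 4)

/-! ### Card `pants-sphere-partner` — first lemmas -/

/-- **PARTNER LEMMA (provable-now candidate, GIVEN the vendored MSZ16 Thm 1.2).** A smooth
homotopy 4-sphere obtained by surgery on an embedded circle in a closed connected oriented smooth
4-manifold `X'` of trisection genus `≤ 2` is diffeomorphic to `S⁴`.  Route: `H₂(X') = 0` and
`π₁`-bookkeeping exclude every MSZ output but `X' ≅ S¹ × S³` with `[ℓ]` a generator (type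
`(2;0,0,0)` is excluded homologically, `#²(S¹ × S³)` by `π₁`, `±ℂP²` summands by `b₂`); then
`ℓ` is homotopic, hence smoothly isotopic (`isSmoothlyIsotopic_circle_of_homotopic`, proved), to
`S¹ × {pt}`, and both framings of that surgery give `S⁴`
(`SphereFourCircleSurgery.lean`, proved).  Further named inputs: `nonempty_circleNbhd`,
`nonempty_diffeomorph_of_isCircleSurgery_of_eq`, isotopy extension. -/
theorem partner_lemma (hMSZ : msz_trisection_classification_gk.{0})
    (M : Type) [TopologicalSpace M] [T2Space M] [SecondCountableTopology M]
    [ChartedSpace (𝔼 4) M] [IsManifold (𝓡 4) ∞ M] (e : M ≃ₕ 𝕊 4)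
    (X' : Type) [TopologicalSpace X'] [T2Space X'] [SecondCountableTopology X']
    [ChartedSpace (𝔼 4) X'] [IsManifold (𝓡 4) ∞ X'] [CompactSpace X'] [ConnectedSpace X']
    (o : SmoothOrientation (𝓡 4) X') (ℓ : 𝕊 1 → X')
    (hℓ : Manifold.IsSmoothEmbedding (𝓡 1) (𝓡 4) ∞ ℓ)
    (hsurg : IsCircleSurgery (𝓡 4) (𝓡 4) X' M ℓ)
    (g : ℕ) (hg : g ≤ 2) (k : Fin 3 → ℕ) (T' : Fin 3 → Set X') (hT' : IsGKTrisection X' g k T') :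
    Nonempty (M ≃ₘ⟮𝓡 4, 𝓡 4⟯ 𝕊 4) := by
  sorry

/-- **THE PARTNER (hardest stub of the card; AZ25 Lemma 5.4 + Prop. 5.5 at type `(3;1,1,1)`,
to be built INTRINSICALLY as surgery on the pants sphere of the five-chain).** A smooth homotopy
4-sphere `M` with a balanced genus-`3` GK-trisection containing a five-chain is obtained by surgery
on an embedded circle `ℓ` in a closed connected oriented smooth 4-manifold `X'` carrying a
genus-`2` GK-trisection. -/
def FiveChainPartner : Prop :=
  ∀ (M : Type) [TopologicalSpace M] [T2Space M] [SecondCountableTopology M]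
    [ChartedSpace (𝔼 4) M] [IsManifold (𝓡 4) ∞ M],
    M ≃ₕ 𝕊 4 → ∀ T : Fin 3 → Set M, IsGKTrisection M 3 (fun _ => 1) T → ContainsFiveChain T →
      ∃ (X' : Type) (_ : TopologicalSpace X') (_ : T2Space X') (_ : SecondCountableTopology X')
        (_ : ChartedSpace (𝔼 4) X') (_ : IsManifold (𝓡 4) ∞ X') (_ : CompactSpace X')
        (_ : ConnectedSpace X') (_ : SmoothOrientation (𝓡 4) X') (ℓ : 𝕊 1 → X')
        (g : ℕ) (k : Fin 3 → ℕ) (T' : Fin 3 → Set X'),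
        Manifold.IsSmoothEmbedding (𝓡 1) (𝓡 4) ∞ ℓ ∧ IsCircleSurgery (𝓡 4) (𝓡 4) X' M ℓ ∧
          g ≤ 2 ∧ IsGKTrisection X' g k T'

/-! ### The signatures fit: compositions (proved, no `sorry` of their own) -/

/-- Card `pants-sphere-partner` discharges the hub of card `five-chain-hub`. -/
theorem fiveChainStandardHS_of_partner (hMSZ : msz_trisection_classification_gk.{0})
    (hP : FiveChainPartner) : FiveChainStandardHS := by
  intro M _ _ _ _ _ e T hT h5
  obtain ⟨X', _, _, _, _, _, _, _, o, ℓ, g, k, T', hℓ, hsurg, hg, hT'⟩ := hP M e T hT h5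
  exact partner_lemma hMSZ M e X' o ℓ hℓ hsurg g hg k T' hT'

/-- The hub architecture closes the crux BY NAME through the tree's proved reduction
`arandaZupan_dependentTriple_genusThree_homotopySphere_of_facts_of_fiveChainCase`
(the four named facts of the route's cone + the 3-D half + the hub). -/
theorem crux_of_hub
    (hWR : arandaZupan_weaklyReducible_genusThree_homotopySphere)
    (hMSZ : Literature.Barriers.SmoothPoincare4.msz_homotopySphere_gk.{0})
    (hsep : Trisection.isConnectedSum_of_reducing_separating.{0})
    (hns : Trisection.isConnectedSum_circleProd_of_reducing_nonseparating.{0})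
    (h3D : ∀ (M : Type) [TopologicalSpace M] [T2Space M] [SecondCountableTopology M]
      [ChartedSpace (𝔼 4) M] [IsManifold (𝓡 4) ∞ M] (T : Fin 3 → Set M),
      IsGKTrisection M 3 (fun _ => 1) T → Trisection.HasDependentTriple T →
        ¬ Trisection.IsWeaklyReducible T → ∃ σ : Equiv.Perm (Fin 3), ContainsFiveChain (T ∘ σ))
    (hub : FiveChainStandardHS) :
    Summit.SmoothPoincare4.SmoothPoincare4.Theses.WeakReductionDescent.DependentTripleGenusThreeStandard := by
  refine Summit.SmoothPoincare4.SmoothPoincare4.Theorems.dependentTripleGenusThreeStandard_of_arandaZupan ?_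
  refine arandaZupan_dependentTriple_genusThree_homotopySphere_of_facts_of_fiveChainCase
    hWR hMSZ hsep hns fun M _ _ _ _ _ e T hT hdt hwr _ => ?_
  obtain ⟨σ, h5⟩ := h3D M T hT hdt hwr
  exact hub M e (T ∘ σ) (hT.comp_perm σ) h5

end Summit.SmoothPoincare4.SmoothPoincare4.Cruxes.DependentTripleGenusThreeStandard.IdeaSketch

end
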